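import Mathlib.LinearAlgebra.Matrix.GeneralLinearGroup.Projective
import Mathlib.RingTheory.LocalRing.ResidueField.Basic
import Mathlib.GroupTheory.SpecificGroups.Dihedral
import Mathlib.Algebra.CharP.Lemmas
import Literature.NumberTheory.GaloisRepresentations.ProjectiveType
import HarnessLib

/-!
# Torsion in the kernel of reduction of `GL_n(O)` and `PGL₂(O)` over a local ring;
# reduction is injective on dihedral subgroups of `PGL₂(O)` (Khare–Wintenberger (I), §6)

Topic `Literature/NumberTheory/GaloisRepresentations`; theorems only (no definition, no named
fact).  `O` is a commutative local ring with maximal ideal `𝔪` and residue field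
`k = O/𝔪` (`IsLocalRing.ResidueField O`, `IsLocalRing.residue`), and "reduction" is
`Matrix.GeneralLinearGroup.map (residue O) : GL_n(O) → GL_n(k)` resp.
`Matrix.ProjGenLinGroup.map (residue O) : PGL_n(O) → PGL_n(k)` (Mathlib's
`PGL(n, R) = GL_n(R) ⧸ Z(GL_n(R))`, the centre being the scalars,
`Matrix.GeneralLinearGroup.center_eq_range_scalar`).

In the proof of Lemma 6.3 of *Serre's modularity conjecture (I)* Khare–Wintenberger use the
following "observation" to transport the shape of `ρ̄|_{D_q}` along a compatible system:

> Let `a ≥ 1` be an integer, let `t ≠ 2` and `r` be distinct primes.  Let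
> `D_{2t^a} ⊂ PGL₂(ℚ̄_r)` be the dihedral group of order `2t^a` which we may assume to be a
> subgroup of `PGL₂(O)` with `O` the valuation ring of `ℚ̄_r`.  Then the reduction map is
> bijective on `D_{2t^a}`.

We prove it for every commutative local ring `O` in which `t` is invertible
(`KhareWintenberger2009.injOn_reduction_dihedral`, from
`LocalRingReduction.injOn_map_residue_of_mulEquiv_dihedralGroup`: reduction is injective on any
subgroup of `PGL₂(O)` isomorphic to `D_{2n}` with `n > 1` odd and invertible in `O` — the
residue characteristic may be `2`), through the two standard facts behind it:

* `LocalRingReduction.matrix_eq_one_of_pow_eq_one` — **torsion of invertible order in the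
  kernel of reduction is trivial** (any size `n × n`): if `g ≡ 1 (mod 𝔪)`, `g ^ m = 1` and
  `m ∈ O^×` then `g = 1`.  Proof: `(∑_{i<m} g^i)(g - 1) = g^m - 1 = 0` and
  `∑_{i<m} g^i ≡ m·1 (mod 𝔪)` has unit determinant.  (`GL` form:
  `units_eq_one_of_pow_eq_one`; injectivity on subgroups of invertible exponent / order:
  `injOn_map_residue_GL_of_forall_pow_eq_one`, `injOn_map_residue_GL_of_isUnit_card`.)
* `LocalRingReduction.mem_range_scalar_of_pow_mem` — **projective version for `2 × 2`
  matrices**: if `g ∈ GL₂(O)` is scalar modulo `𝔪` and `g ^ m` is scalar with `m ∈ O^×`, then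
  `g` is scalar.  Proof (no Hensel lemma needed): writing `g = c·1 + Y` with `Y ≡ 0 (mod 𝔪)`,
  Cayley–Hamilton `Y² = tr(Y) Y - det(Y)` gives `g^j = P_j·1 + Q_j·Y` with
  `P_j ≡ c^j`, `Q_j c ≡ j c^j (mod 𝔪)`; at `j = m`, `Q_m` is a unit and `Q_m Y = (μ - P_m)·1`
  forces `Y`, hence `g`, to be scalar.  Consequences in `PGL₂`:
  `projGenLinGroup_eq_one_of_pow_eq_one` (an element of the kernel of
  `PGL₂(O) → PGL₂(k)` of invertible finite order is trivial),
  `injOn_map_residue_of_forall_pow_eq_one`, `injOn_map_residue_of_isUnit_card` (reduction is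
  injective on subgroups of invertible exponent / finite subgroups of invertible order — this
  already covers `D_{2t^a}` when the residue characteristic is odd and `≠ t`), and the dihedral
  statement above, where for residue characteristic `2` the reflections are handled by
  normality: a reflection `s` in the kernel would put `s · (ρ s ρ⁻¹) = ρ^{-2}`, a rotation of
  order `n > 1`, in the kernel.

Mathlib supplies `Matrix.ProjGenLinGroup` (`PGL(n, R)`, `mk`, `map`, `mk_eq_one`),
`Matrix.GeneralLinearGroup.map` / `center_eq_range_scalar` /
`mem_center_iff_val_mem_range_scalar`, `IsLocalRing.residue` (`residue_ne_zero_iff_isUnit`,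
`residue_eq_zero_iff`), `geom_sum_mul`, `RingHom.map_det`, and `DihedralGroup` with its
multiplication table; nothing is redefined.

## References

* C. Khare, J.-P. Wintenberger, *Serre's modularity conjecture (I)*, Invent. Math. 178 (2009),
  485–504, §6, proof of Lemma 6.3 (the displayed observation). [KhareWintenberger2009]
* For the kernel lemma in `GL_n` (Minkowski; torsion in `ker (GL_n(ℤ_ℓ) → GL_n(𝔽_ℓ))` is
  `ℓ`-primary): J.-P. Serre, *Rigidité du foncteur de Jacobi d'échelon `n ≥ 3`*, appendix to
  A. Grothendieck, Sém. H. Cartan 13 (1960/61), Exp. 17 — classical, recorded here as folklore.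
-/

open Matrix IsLocalRing
open scoped MatrixGroups

namespace Literature.NumberTheory.GaloisRepresentations

namespace LocalRingReduction

variable {O : Type*} [CommRing O] [IsLocalRing O]

/-! ### Torsion of invertible order in `ker (GL_n(O) → GL_n(k))` is trivial -/

section GeneralLinear

variable {ι : Type*} [Fintype ι] [DecidableEq ι]

/-- A natural number that is a unit in the local ring `O` is non-zero in the residue field.
[folklore] -/
theorem residue_natCast_ne_zero {m : ℕ} (hm : IsUnit (m : O)) :
    (m : ResidueField O) ≠ 0 := by
  rw [← map_natCast (residue O) m]
  exact (residue_ne_zero_iff_isUnit _).mpr hm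

omit [IsLocalRing O] in
/-- A divisor of a natural number invertible in `O` is invertible in `O`. [folklore] -/
theorem isUnit_natCast_of_dvd {a b : ℕ} (h : a ∣ b) (hb : IsUnit (b : O)) : IsUnit (a : O) := by
  obtain ⟨c, rfl⟩ := h
  rw [Nat.cast_mul] at hb
  exact isUnit_of_mul_isUnit_left hb

/-- **Torsion of invertible order in the kernel of reduction is trivial.**  Let `O` be a
commutative local ring with residue field `k`, `g` an `n × n` matrix over `O` with
`g ≡ 1 (mod 𝔪)` and `g ^ m = 1` for some `m` invertible in `O`.  Then `g = 1`.
Proof: `(∑_{i<m} g^i) (g - 1) = g^m - 1 = 0`, and `∑_{i<m} g^i ≡ m · 1 (mod 𝔪)` has determinant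
`≡ m^n`, a unit, so it is invertible and `g - 1 = 0`. [folklore] -/
theorem matrix_eq_one_of_pow_eq_one {g : Matrix ι ι O} (hg : g.map (residue O) = 1) {m : ℕ}
    (hm : IsUnit (m : O)) (hpow : g ^ m = 1) : g = 1 := by
  set S : Matrix ι ι O := ∑ i ∈ Finset.range m, g ^ i with hS_def
  have hS : S * (g - 1) = 0 := by rw [hS_def, geom_sum_mul, hpow, sub_self]
  -- the reduction of `S` is `m • 1`
  have hSres : (residue O).mapMatrix S = (m : ResidueField O) • (1 : Matrix ι ι (ResidueField O)) := by
    have hg' : (residue O).mapMatrix g = 1 := by rw [RingHom.mapMatrix_apply, hg]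
    rw [hS_def, map_sum]
    simp_rw [map_pow, hg', one_pow, Finset.sum_const, Finset.card_range]
    rw [← Nat.cast_smul_eq_nsmul (ResidueField O)]
  -- hence `det S` is a unit
  have hdet : IsUnit S.det := by
    rw [← residue_ne_zero_iff_isUnit, RingHom.map_det, hSres, det_smul, det_one, mul_one]
    exact pow_ne_zero _ (residue_natCast_ne_zero hm)
  obtain ⟨u, hu⟩ := (isUnit_iff_isUnit_det S).mpr hdet
  have h0 : g - 1 = 0 := by
    calc g - 1 = (↑u⁻¹ * S) * (g - 1) := by rw [← hu, Units.inv_mul, one_mul]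
      _ = 0 := by rw [mul_assoc, hS, mul_zero]
  exact sub_eq_zero.mp h0

/-- `GL_n` form of `matrix_eq_one_of_pow_eq_one`: an element of the kernel of the reduction
`GL_n(O) → GL_n(k)` whose order is invertible in `O` is trivial. [folklore] -/
theorem units_eq_one_of_pow_eq_one {g : GL ι O}
    (hg : Matrix.GeneralLinearGroup.map (residue O) g = 1) {m : ℕ} (hm : IsUnit (m : O))
    (hpow : g ^ m = 1) : g = 1 := by
  have hg' : (g : Matrix ι ι O).map (residue O) = 1 := by
    have := congrArg (fun x : GL ι (ResidueField O) => (x : Matrix ι ι (ResidueField O))) hg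
    simpa using this
  have hpow' : (g : Matrix ι ι O) ^ m = 1 := by
    rw [← Units.val_pow_eq_pow_val, hpow, Units.val_one]
  exact Units.ext (matrix_eq_one_of_pow_eq_one hg' hm hpow')

/-- Reduction `GL_n(O) → GL_n(k)` is injective on every subgroup all of whose elements have a
finite order invertible in `O`. [folklore] -/
theorem injOn_map_residue_GL_of_forall_pow_eq_one {H : Subgroup (GL ι O)}
    (hH : ∀ x ∈ H, ∃ m : ℕ, IsUnit (m : O) ∧ x ^ m = 1) :
    Set.InjOn (Matrix.GeneralLinearGroup.map (residue O)) (H : Set (GL ι O)) := by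
  intro x hx y hy hxy
  obtain ⟨m, hm, hpow⟩ := hH (x * y⁻¹) (H.mul_mem hx (H.inv_mem hy))
  have h1 : Matrix.GeneralLinearGroup.map (residue O) (x * y⁻¹) = 1 := by
    rw [map_mul, map_inv, hxy, mul_inv_cancel]
  exact mul_inv_eq_one.mp (units_eq_one_of_pow_eq_one h1 hm hpow)

/-- Reduction `GL_n(O) → GL_n(k)` is injective on every finite subgroup whose order is invertible
in `O` (e.g. prime to the residue characteristic). [folklore] -/
theorem injOn_map_residue_GL_of_isUnit_card {H : Subgroup (GL ι O)}
    (hH : IsUnit (Nat.card H : O)) :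
    Set.InjOn (Matrix.GeneralLinearGroup.map (residue O)) (H : Set (GL ι O)) := by
  refine injOn_map_residue_GL_of_forall_pow_eq_one fun x hx => ⟨Nat.card H, hH, ?_⟩
  have h := pow_card_eq_one' (x := (⟨x, hx⟩ : H))
  rw [Subtype.ext_iff, Subgroup.coe_pow] at h
  exact h

end GeneralLinear

/-! ### The projective kernel lemma for `2 × 2` matrices -/

section TwoByTwo

/-- The recursion behind the projective kernel lemma: if `Y ≡ 0 (mod 𝔪)` then for every `j`
there are `P, Q ∈ O` with `(c·1 + Y)^j = P·1 + Q·Y`, `P ≡ c^j` and `Q c ≡ j c^j (mod 𝔪)`.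
[folklore] -/
theorem exists_pow_eq_smul_one_add_smul {Y : Matrix (Fin 2) (Fin 2) O}
    (hY : ∀ i j, residue O (Y i j) = 0) (c : O) (j : ℕ) :
    ∃ P Q : O, (c • (1 : Matrix (Fin 2) (Fin 2) O) + Y) ^ j = P • 1 + Q • Y ∧
      residue O P = residue O c ^ j ∧
      residue O Q * residue O c = j * residue O c ^ j := by
  induction j with
  | zero => exact ⟨1, 0, by simp, by simp, by simp⟩
  | succ j ih =>
    obtain ⟨P, Q, hPQ, hP, hQ⟩ := ih
    refine ⟨P * c - Q * Y.det, P + Q * c + Q * Y.trace, ?_, ?_, ?_⟩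
    · -- Cayley–Hamilton `Y² = tr(Y) Y - det(Y)·1` (the tree's
      -- `DeuringLadic.Matrix.sq_eq_trace_smul_sub_det_fin_two`), checked entrywise
      rw [pow_succ, hPQ]
      ext i k
      fin_cases i <;> fin_cases k <;>
        simp [Matrix.mul_apply, Fin.sum_univ_two, Matrix.trace_fin_two, Matrix.det_fin_two,
          Matrix.one_apply] <;> ring
    · have hdet : residue O Y.det = 0 := by
        simp [Matrix.det_fin_two, hY]
      simp [hP, hdet, pow_succ]
    · have htr : residue O Y.trace = 0 := by
        simp [Matrix.trace_fin_two, hY]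
      have h1 : residue O (P + Q * c + Q * Y.trace) * residue O c
          = residue O c ^ j * residue O c + residue O Q * residue O c * residue O c := by
        simp only [map_add, map_mul, htr, hP]; ring
      rw [h1, hQ]
      push_cast
      ring

/-- **Projective kernel lemma (`2 × 2`).**  Let `g ∈ M₂(O)` have unit determinant, be scalar
modulo `𝔪`, and have a scalar power `g ^ m` with `m` invertible in `O`.  Then `g` is scalar.
(Equivalently: an element of the kernel of `PGL₂(O) → PGL₂(k)` of finite order invertible in
`O` is trivial, `projGenLinGroup_eq_one_of_pow_eq_one`.)  Proof by the recursion
`exists_pow_eq_smul_one_add_smul`: `g = c·1 + Y`, `g^m = P·1 + Q·Y = μ·1` with `Q` a unit, so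
`Y = Q⁻¹(μ - P)·1`. [folklore] -/
theorem mem_range_scalar_of_pow_mem {g : Matrix (Fin 2) (Fin 2) O}
    (hg : g.map (residue O) ∈ Set.range (Matrix.scalar (Fin 2))) (hdet : IsUnit g.det)
    {m : ℕ} (hm : IsUnit (m : O)) (hpow : g ^ m ∈ Set.range (Matrix.scalar (Fin 2))) :
    g ∈ Set.range (Matrix.scalar (Fin 2)) := by
  obtain ⟨a, ha⟩ := hg
  obtain ⟨c, rfl⟩ := residue_surjective a
  obtain ⟨μ, hμ⟩ := hpow
  -- `Y := g - c • 1` reduces to `0`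
  set Y : Matrix (Fin 2) (Fin 2) O := g - c • 1 with hY_def
  have hY : ∀ i j, residue O (Y i j) = 0 := by
    intro i j
    have hij := congrFun (congrFun ha i) j
    simp only [Matrix.map_apply, Matrix.scalar_apply, Matrix.diagonal_apply] at hij
    simp only [hY_def, Matrix.sub_apply, Matrix.smul_apply, Matrix.one_apply, smul_eq_mul,
      map_sub, map_mul, ← hij]
    split_ifs <;> simp
  have hgY : g = c • 1 + Y := by rw [hY_def, add_sub_cancel]
  -- the residue `c̄` of `c` is non-zero, as `det g ≡ c²`
  have hc : residue O c ≠ 0 := by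
    have h1 : residue O g.det ≠ 0 := (residue_ne_zero_iff_isUnit _).mpr hdet
    rw [RingHom.map_det, RingHom.mapMatrix_apply, ← ha] at h1
    intro h0
    apply h1
    simp [Matrix.scalar_apply, h0]
  -- the recursion at `j = m`
  obtain ⟨P, Q, hPQ, -, hQ⟩ := exists_pow_eq_smul_one_add_smul hY c m
  have hQu : IsUnit Q := by
    rw [← residue_ne_zero_iff_isUnit]
    intro h0
    rw [h0, zero_mul] at hQ
    exact (mul_ne_zero (residue_natCast_ne_zero hm) (pow_ne_zero _ hc)) hQ.symm
  obtain ⟨q, rfl⟩ := hQu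
  -- `q • Y = (μ - P) • 1`, so `Y` is scalar
  have hQY : (q : O) • Y = (μ - P) • (1 : Matrix (Fin 2) (Fin 2) O) := by
    have h1 : P • (1 : Matrix (Fin 2) (Fin 2) O) + (q : O) • Y = μ • 1 := by
      rw [← hPQ, ← hgY, ← hμ, Matrix.scalar_apply, ← Matrix.smul_one_eq_diagonal]
    rw [sub_smul, ← h1, add_sub_cancel_left]
  have hYs : Y = ((q⁻¹ : Oˣ) : O) • (μ - P) • (1 : Matrix (Fin 2) (Fin 2) O) := by
    rw [← hQY, smul_smul, Units.inv_mul, one_smul]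
  refine ⟨c + (q⁻¹ : Oˣ) * (μ - P), ?_⟩
  rw [hgY, hYs, Matrix.scalar_apply, ← Matrix.smul_one_eq_diagonal, add_smul, smul_smul]

end TwoByTwo

/-! ### Consequences in `PGL₂(O)` -/

section Projective

/-- **An element of `ker (PGL₂(O) → PGL₂(k))` of finite order invertible in `O` is trivial.**
[folklore] -/
theorem projGenLinGroup_eq_one_of_pow_eq_one {x : PGL(Fin 2, O)}
    (hx : Matrix.ProjGenLinGroup.map (residue O) x = 1) {m : ℕ} (hm : IsUnit (m : O))
    (hpow : x ^ m = 1) : x = 1 := by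
  induction x using Matrix.ProjGenLinGroup.induction_on with
  | mk g =>
    rw [Matrix.ProjGenLinGroup.map_mk, Matrix.ProjGenLinGroup.mk_eq_one,
      Matrix.GeneralLinearGroup.mem_center_iff_val_mem_range_scalar] at hx
    rw [← map_pow, Matrix.ProjGenLinGroup.mk_eq_one,
      Matrix.GeneralLinearGroup.mem_center_iff_val_mem_range_scalar, Units.val_pow_eq_pow_val]
      at hpow
    rw [Matrix.ProjGenLinGroup.mk_eq_one,
      Matrix.GeneralLinearGroup.mem_center_iff_val_mem_range_scalar]
    have hg : (g : Matrix (Fin 2) (Fin 2) O).map (residue O) ∈ Set.range (Matrix.scalar (Fin 2)) :=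
      hx
    exact mem_range_scalar_of_pow_mem hg (Matrix.isUnits_det_units g) hm hpow

/-- Reduction `PGL₂(O) → PGL₂(k)` is injective on every subgroup all of whose elements have a
finite order invertible in `O`. [folklore] -/
theorem injOn_map_residue_of_forall_pow_eq_one {H : Subgroup PGL(Fin 2, O)}
    (hH : ∀ x ∈ H, ∃ m : ℕ, IsUnit (m : O) ∧ x ^ m = 1) :
    Set.InjOn (Matrix.ProjGenLinGroup.map (residue O)) (H : Set PGL(Fin 2, O)) := by
  intro x hx y hy hxy
  obtain ⟨m, hm, hpow⟩ := hH (x * y⁻¹) (H.mul_mem hx (H.inv_mem hy))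
  have h1 : Matrix.ProjGenLinGroup.map (residue O) (x * y⁻¹) = 1 := by
    rw [map_mul, map_inv, hxy, mul_inv_cancel]
  exact mul_inv_eq_one.mp (projGenLinGroup_eq_one_of_pow_eq_one h1 hm hpow)

/-- Reduction `PGL₂(O) → PGL₂(k)` is injective on every finite subgroup whose order is
invertible in `O`; in particular on a dihedral subgroup `D_{2t^a}` when the residue
characteristic is odd and different from `t`. [folklore] -/
theorem injOn_map_residue_of_isUnit_card {H : Subgroup PGL(Fin 2, O)}
    (hH : IsUnit (Nat.card H : O)) :
    Set.InjOn (Matrix.ProjGenLinGroup.map (residue O)) (H : Set PGL(Fin 2, O)) := by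
  refine injOn_map_residue_of_forall_pow_eq_one fun x hx => ⟨Nat.card H, hH, ?_⟩
  have h := pow_card_eq_one' (x := (⟨x, hx⟩ : H))
  rw [Subtype.ext_iff, Subgroup.coe_pow] at h
  exact h

/-- In a subgroup `H ≅ D_{2n}` of `PGL₂(O)` with `n` invertible in `O`, a *rotation* lying in
the kernel of reduction is trivial. [folklore] -/
theorem coe_eq_one_of_eq_r {H : Subgroup PGL(Fin 2, O)} {n : ℕ} (e : H ≃* DihedralGroup n)
    (hu : IsUnit (n : O)) (w : H)
    (hw : Matrix.ProjGenLinGroup.map (residue O) (w : PGL(Fin 2, O)) = 1)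
    (hr : ∃ i, e w = DihedralGroup.r i) : (w : PGL(Fin 2, O)) = 1 := by
  obtain ⟨i, hi⟩ := hr
  have hpow : w ^ n = 1 := by
    apply e.injective
    rw [map_pow, hi, map_one, DihedralGroup.r_pow, ZMod.natCast_self, mul_zero,
      DihedralGroup.one_def]
  have hpow' : (w : PGL(Fin 2, O)) ^ n = 1 := by
    rw [← Subgroup.coe_pow, hpow, Subgroup.coe_one]
  exact projGenLinGroup_eq_one_of_pow_eq_one hw hu hpow'

/-- **Reduction is injective on dihedral subgroups of `PGL₂(O)` of order `2n`, `n > 1` odd and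
invertible in `O`** — whatever the residue characteristic (including `2`).  Rotations in the
kernel die by `coe_eq_one_of_eq_r`; if a reflection `s` were in the kernel, so would be
`s · (ρ s ρ⁻¹) = ρ^{-2}` (`ρ` a generator of the rotations), a rotation of order `n > 1`,
contradiction. [cite: KhareWintenberger2009, §6, proof of Lemma 6.3] -/
theorem injOn_map_residue_of_mulEquiv_dihedralGroup {H : Subgroup PGL(Fin 2, O)} {n : ℕ}
    (e : H ≃* DihedralGroup n) (hn : Odd n) (hn1 : n ≠ 1) (hu : IsUnit (n : O)) :
    Set.InjOn (Matrix.ProjGenLinGroup.map (residue O)) (H : Set PGL(Fin 2, O)) := by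
  haveI : NeZero n := ⟨hn.pos.ne'⟩
  -- every element of `H` in the kernel of reduction is trivial
  have key : ∀ z ∈ H, Matrix.ProjGenLinGroup.map (residue O) z = 1 → z = 1 := by
    intro z hz hz1
    rcases hd : e ⟨z, hz⟩ with i | i
    · exact coe_eq_one_of_eq_r e hu ⟨z, hz⟩ hz1 ⟨i, hd⟩
    · exfalso
      -- conjugate the reflection `z` by the rotation `ρ = e⁻¹ (r 1)` and multiply
      set ρ : H := e.symm (DihedralGroup.r 1) with hρ
      set u : H := ⟨z, hz⟩ * (ρ * ⟨z, hz⟩ * ρ⁻¹) with hu_def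
      have hu1 : Matrix.ProjGenLinGroup.map (residue O) (u : PGL(Fin 2, O)) = 1 := by
        simp only [hu_def, Subgroup.coe_mul, Subgroup.coe_inv, map_mul, map_inv, hz1,
          mul_one, mul_inv_cancel]
      have heu : e u = DihedralGroup.r (-2) := by
        simp only [hu_def, map_mul, map_inv, hd, hρ, MulEquiv.apply_symm_apply,
          DihedralGroup.inv_r, DihedralGroup.r_mul_sr, DihedralGroup.sr_mul_r,
          DihedralGroup.sr_mul_sr]
        congr 1
        ring
      have hu2 : (u : PGL(Fin 2, O)) = 1 := coe_eq_one_of_eq_r e hu u hu1 ⟨-2, heu⟩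
      have hu3 : u = 1 := Subtype.ext hu2
      rw [hu3, map_one, DihedralGroup.one_def] at heu
      have h2 : ((2 : ℕ) : ZMod n) = 0 := by
        have h := DihedralGroup.r.inj heu
        have h' : (2 : ZMod n) = 0 := by
          have := congrArg Neg.neg h
          simpa using this.symm
        exact_mod_cast h'
      rw [ZMod.natCast_eq_zero_iff] at h2
      rcases (Nat.dvd_prime Nat.prime_two).mp h2 with h | h
      · exact hn1 h
      · rw [h] at hn
        exact absurd hn (by decide)
  intro x hx y hy hxy
  have h1 : Matrix.ProjGenLinGroup.map (residue O) (x * y⁻¹) = 1 := by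
    rw [map_mul, map_inv, hxy, mul_inv_cancel]
  exact mul_inv_eq_one.mp (key (x * y⁻¹) (H.mul_mem hx (H.inv_mem hy)) h1)

end Projective

/-! ### Projective images of representations and their reductions -/

section ProjectiveImage

variable {G : Type*} [Group G]

omit [IsLocalRing O] in
/-- **The projective image of the reduction is the reduction of the projective image**: for a
ring homomorphism `f : R → S` and `ρ : G → GL_n(R)`,
`projectiveImage (f ∘ ρ) = (projectiveImage ρ).map (PGL_n(f))`. [folklore] -/
theorem projectiveImage_map_comp {S : Type*} [CommRing S] {ι : Type*} [Fintype ι] [DecidableEq ι]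
    (f : O →+* S) (ρ : G →* GL ι O) :
    projectiveImage ((Matrix.GeneralLinearGroup.map f).comp ρ) =
      (projectiveImage ρ).map (Matrix.ProjGenLinGroup.map f) := by
  have h : Matrix.ProjGenLinGroup.mk.comp ((Matrix.GeneralLinearGroup.map f).comp ρ)
      = (Matrix.ProjGenLinGroup.map f).comp (Matrix.ProjGenLinGroup.mk.comp ρ) := by
    ext g
    rfl
  unfold projectiveImage
  rw [h, MonoidHom.range_comp]

omit [IsLocalRing O] in
/-- If `PGL_n(f)` is injective on the projective image of `ρ`, the projective image of `f ∘ ρ`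
is isomorphic to that of `ρ`. [folklore] -/
theorem nonempty_projectiveImage_comp_mulEquiv_of_injOn {S : Type*} [CommRing S] {ι : Type*}
    [Fintype ι] [DecidableEq ι] (f : O →+* S) (ρ : G →* GL ι O)
    (hinj : Set.InjOn (Matrix.ProjGenLinGroup.map f) (projectiveImage ρ : Set PGL(ι, O))) :
    Nonempty (projectiveImage ((Matrix.GeneralLinearGroup.map f).comp ρ) ≃* projectiveImage ρ) := by
  rw [projectiveImage_map_comp]
  refine ⟨(MulEquiv.ofBijective ((Matrix.ProjGenLinGroup.map f).subgroupMap (projectiveImage ρ))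
    ⟨?_, MonoidHom.subgroupMap_surjective _ _⟩).symm⟩
  intro x y hxy
  apply Subtype.ext
  apply hinj x.2 y.2
  have := congrArg Subtype.val hxy
  simpa only [MonoidHom.subgroupMap_apply_coe] using this

/-- **A projectively dihedral `ρ : G → GL₂(O)` of type `D_{2n}`, `n > 1` odd and invertible in
`O`, stays projectively dihedral of the same type after reduction modulo `𝔪`** (the form in
which Khare–Wintenberger use the observation: the mod-`r` representations of the compatible
system restricted to `D_q` keep the dihedral projective image of order `2t^a`).
[cite: KhareWintenberger2009, §6, proof of Lemma 6.3] -/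
theorem nonempty_projectiveImage_map_residue_mulEquiv_dihedralGroup {ρ : G →* GL (Fin 2) O}
    {n : ℕ} (e : projectiveImage ρ ≃* DihedralGroup n) (hn : Odd n) (hn1 : n ≠ 1)
    (hu : IsUnit (n : O)) :
    Nonempty (projectiveImage ((Matrix.GeneralLinearGroup.map (residue O)).comp ρ) ≃*
      DihedralGroup n) := by
  obtain ⟨e'⟩ := nonempty_projectiveImage_comp_mulEquiv_of_injOn (residue O) ρ
    (injOn_map_residue_of_mulEquiv_dihedralGroup e hn hn1 hu)
  exact ⟨e'.trans e⟩

/-- In particular the reduction is of dihedral type (`IsDihedralType`, `m = n ≥ 3`). [folklore] -/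
theorem isDihedralType_map_residue_comp {ρ : G →* GL (Fin 2) O} {n : ℕ}
    (e : projectiveImage ρ ≃* DihedralGroup n) (hn : Odd n) (hn1 : n ≠ 1) (hu : IsUnit (n : O)) :
    IsDihedralType ((Matrix.GeneralLinearGroup.map (residue O)).comp ρ) := by
  refine ⟨n, ?_, nonempty_projectiveImage_map_residue_mulEquiv_dihedralGroup e hn hn1 hu⟩
  rcases hn with ⟨j, rfl⟩
  omega

end ProjectiveImage

end LocalRingReduction

end Literature.NumberTheory.GaloisRepresentations

namespace Literature.NumberTheory.GaloisRepresentations.KhareWintenberger2009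

open LocalRingReduction

/-- A prime `t` different from the residue characteristic `r` of the local ring `O` is
invertible in `O`, and so are its powers. [folklore] -/
theorem isUnit_natCast_prime_pow_of_ne_char {O : Type*} [CommRing O] [IsLocalRing O] {r : ℕ}
    [CharP (ResidueField O) r] {t : ℕ} (ht : t.Prime) (htr : t ≠ r) (a : ℕ) :
    IsUnit ((t ^ a : ℕ) : O) := by
  rw [← residue_ne_zero_iff_isUnit, map_natCast, Nat.cast_pow]
  refine pow_ne_zero _ fun h0 => ?_
  rw [CharP.cast_eq_zero_iff (ResidueField O) r] at h0
  rcases CharP.char_is_prime_or_zero (ResidueField O) r with hr | hr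
  · exact htr ((Nat.prime_dvd_prime_iff_eq hr ht).mp h0).symm
  · rw [hr, zero_dvd_iff] at h0
    exact ht.ne_zero h0

/-- **Khare–Wintenberger (I), §6, proof of Lemma 6.3 — the observation as printed.**  Let
`a ≥ 1`, let `t ≠ 2` and `r` be distinct primes, and let `O` be a commutative local ring of
residue characteristic `r` (in the paper: the valuation ring of `ℚ̄_r`).  If
`D_{2t^a} ≅ H ⊂ PGL₂(O)` is a dihedral subgroup of order `2t^a`, then the reduction map
`PGL₂(O) → PGL₂(k)` is bijective from `H` onto its image, i.e. injective on `H`.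
[cite: KhareWintenberger2009, §6, proof of Lemma 6.3] -/
theorem injOn_reduction_dihedral {O : Type*} [CommRing O] [IsLocalRing O] {r : ℕ}
    [CharP (ResidueField O) r] {t a : ℕ} (ht : t.Prime) (ht2 : t ≠ 2) (htr : t ≠ r)
    (ha : 1 ≤ a) {H : Subgroup PGL(Fin 2, O)} (e : H ≃* DihedralGroup (t ^ a)) :
    Set.InjOn (Matrix.ProjGenLinGroup.map (residue O)) (H : Set PGL(Fin 2, O)) :=
  injOn_map_residue_of_mulEquiv_dihedralGroup e (ht.odd_of_ne_two ht2).pow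
    (Nat.one_lt_pow (by omega) ht.one_lt).ne' (isUnit_natCast_prime_pow_of_ne_char ht htr a)

/-- **The same observation for a representation**: if `ρ : G → GL₂(O)` is projectively dihedral
of type `D_{2t^a}` (`t ≠ 2`, `t ≠ r` primes, `a ≥ 1`), so is its reduction modulo `𝔪`.
[cite: KhareWintenberger2009, §6, proof of Lemma 6.3] -/
theorem nonempty_projectiveImage_reduction_mulEquiv_dihedralGroup {O : Type*} [CommRing O]
    [IsLocalRing O] {r : ℕ} [CharP (ResidueField O) r] {G : Type*} [Group G]
    {ρ : G →* GL (Fin 2) O} {t a : ℕ} (ht : t.Prime) (ht2 : t ≠ 2) (htr : t ≠ r) (ha : 1 ≤ a)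
    (e : projectiveImage ρ ≃* DihedralGroup (t ^ a)) :
    Nonempty (projectiveImage ((Matrix.GeneralLinearGroup.map (residue O)).comp ρ) ≃*
      DihedralGroup (t ^ a)) :=
  nonempty_projectiveImage_map_residue_mulEquiv_dihedralGroup e (ht.odd_of_ne_two ht2).pow
    (Nat.one_lt_pow (by omega) ht.one_lt).ne' (isUnit_natCast_prime_pow_of_ne_char ht htr a)

end Literature.NumberTheory.GaloisRepresentations.KhareWintenberger2009
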